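import Summits.ABC.ABC.Theses.FeketeScales
import Summits.ABC.ABC.Theorems.FeketeScalesSubmultOfRST

/-!
# Non-bursts are free — stub `nonBurst_submult` of crux stmt-ABC-2160 `ScaleSubmultiplicativity` (line SketchIdeator3)

Rung A1 of the line: if an abc triple `(a, b, c)` has excess at most `(log rad)^θ + B` with `θ ≥ 0`,
i.e. `c ≤ e^B · rad(abc) · exp((log rad(abc))^θ)`, then for every split `R₁, R₂ ≥ 4` with
`rad(abc) ≤ R₁R₂` the crux inequality `c ≤ 16 e^B · exp((log R₁R₂)^θ) · c₁ c₂` holds, the witnesses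
being the dyadic triples `(1, 2ᵏ - 1, 2ᵏ)` at the scales `R₁`, `R₂` (`cᵢ > Rᵢ/4`,
`SubmultOfRST.exists_triple_at_scale`).  Proof: `rad ≤ R₁R₂ =: P` and `rad ≥ 2` give
`(log rad)^θ ≤ (log P)^θ` (monotonicity of `log`, of `x ↦ x^θ` on `[0, ∞)` for `θ ≥ 0`, of `exp`),
and `P < 16 c₁c₂` from the two witnesses.  Source: BarrierNotesIdeator3 §A1 of the crux workfiles;
uses only Mathlib and `FeketeScalesSubmultOfRST`.
-/

-- `Summit.<Summit>.<Problem>` is the mandated summit-side namespace (CONVENTIONS §2); for the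
-- single-conjunct summit `ABC` the two coincide, so the duplicate `ABC.ABC` is deliberate.
set_option linter.dupNamespace false

namespace Summit.ABC.ABC.Theorems

open Literature.NumberTheory.DiophantineGeometry

/-- **Non-bursts are free** (rung A1 of line SketchIdeator3, crux stmt-ABC-2160).  If an abc triple
satisfies `c ≤ e^B · rad · exp((log rad)^θ)` with `θ ≥ 0`, then for every `R₁, R₂ ≥ 4` with
`rad ≤ R₁R₂` there are abc triples at the scales `R₁`, `R₂` (the dyadic `(1, 2ᵏ - 1, 2ᵏ)` with
`cᵢ > Rᵢ/4`) such that `c ≤ 16 e^B · exp((log R₁R₂)^θ) · c₁ c₂`. [folklore] -/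
theorem ScaleSubmultiplicativity.nonBurst_submult :
    ∀ θ B : ℝ, 0 ≤ θ → ∀ R₁ R₂ : ℕ, 4 ≤ R₁ → 4 ≤ R₂ → ∀ a b c : ℕ, IsABCTriple a b c →
      rad a b c ≤ R₁ * R₂ →
      (c : ℝ) ≤ Real.exp B * (rad a b c : ℝ) * Real.exp (Real.log (rad a b c : ℝ) ^ θ) →
      ∃ a₁ b₁ c₁ a₂ b₂ c₂ : ℕ, IsABCTriple a₁ b₁ c₁ ∧ rad a₁ b₁ c₁ ≤ R₁ ∧ IsABCTriple a₂ b₂ c₂ ∧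
        rad a₂ b₂ c₂ ≤ R₂ ∧
        (c : ℝ) ≤ 16 * Real.exp B * Real.exp (Real.log ((R₁ : ℝ) * R₂) ^ θ) * c₁ * c₂ := by
  intro θ B hθ R₁ R₂ hR₁ hR₂ a b c habc hrad henv
  obtain ⟨a₁, b₁, c₁, h₁, hrad₁, hc₁⟩ := SubmultOfRST.exists_triple_at_scale hR₁
  obtain ⟨a₂, b₂, c₂, h₂, hrad₂, hc₂⟩ := SubmultOfRST.exists_triple_at_scale hR₂
  refine ⟨a₁, b₁, c₁, a₂, b₂, c₂, h₁, hrad₁, h₂, hrad₂, ?_⟩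
  -- the scale `P = R₁ R₂` and the witness bound `P < 16 c₁ c₂`
  set P : ℕ := R₁ * R₂ with hP_def
  have hP16 : P < 16 * (c₁ * c₂) := by
    calc P = R₁ * R₂ := rfl
      _ < (4 * c₁) * (4 * c₂) := Nat.mul_lt_mul'' hc₁ hc₂
      _ = 16 * (c₁ * c₂) := by ring
  have hPreal : ((R₁ : ℝ) * R₂) = (P : ℝ) := by rw [hP_def]; push_cast; ring
  have hP16r : (P : ℝ) ≤ 16 * ((c₁ : ℝ) * c₂) := by exact_mod_cast hP16.le
  -- monotonicity: `(log rad)^θ ≤ (log P)^θ`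
  have hrad2 : (2 : ℝ) ≤ ((rad a b c : ℕ) : ℝ) := by exact_mod_cast SubmultOfRST.two_le_rad habc
  have hrad0 : (0 : ℝ) < ((rad a b c : ℕ) : ℝ) := two_pos.trans_le hrad2
  have hradP : ((rad a b c : ℕ) : ℝ) ≤ (P : ℝ) := by exact_mod_cast hrad
  have hlogr0 : 0 ≤ Real.log ((rad a b c : ℕ) : ℝ) := Real.log_nonneg (one_le_two.trans hrad2)
  have hlogP : Real.log ((rad a b c : ℕ) : ℝ) ≤ Real.log (P : ℝ) := Real.log_le_log hrad0 hradP
  have hexp : Real.exp (Real.log ((rad a b c : ℕ) : ℝ) ^ θ) ≤ Real.exp (Real.log (P : ℝ) ^ θ) :=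
    Real.exp_le_exp.mpr (Real.rpow_le_rpow hlogr0 hlogP hθ)
  have hB0 : 0 ≤ Real.exp B := (Real.exp_pos B).le
  have hexpP0 : 0 ≤ Real.exp (Real.log (P : ℝ) ^ θ) := (Real.exp_pos _).le
  -- assembly
  calc (c : ℝ) ≤ Real.exp B * ((rad a b c : ℕ) : ℝ) * Real.exp (Real.log ((rad a b c : ℕ) : ℝ) ^ θ) :=
        henv
    _ ≤ Real.exp B * (P : ℝ) * Real.exp (Real.log (P : ℝ) ^ θ) :=
        mul_le_mul (mul_le_mul_of_nonneg_left hradP hB0) hexp (Real.exp_pos _).le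
          (mul_nonneg hB0 (Nat.cast_nonneg _))
    _ ≤ Real.exp B * (16 * ((c₁ : ℝ) * c₂)) * Real.exp (Real.log (P : ℝ) ^ θ) :=
        mul_le_mul_of_nonneg_right (mul_le_mul_of_nonneg_left hP16r hB0) hexpP0
    _ = 16 * Real.exp B * Real.exp (Real.log ((R₁ : ℝ) * R₂) ^ θ) * c₁ * c₂ := by
        rw [hPreal]; ring

end Summit.ABC.ABC.Theorems
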